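import Literature.AlgebraicGeometry.Motives.AbelianVarietyEquivariantQuasiDecomposition
import Literature.AlgebraicGeometry.Motives.AbelianVarietyPoincareEquivariantPerfectField
import Mathlib.Algebra.MonoidAlgebra.Basic
import HarnessLib

/-!
# Decomposition up to isogeny into `G`-simple pieces for a finite group `G`, over a perfect field

Instance of the engine `AbelianVariety.exists_equivariant_quasiDecomposition_of_splitting`
(`Motives/AbelianVarietyEquivariantQuasiDecomposition`) for FINITE GROUP actions, through the
group ring: an action `ρ : G →* End X` is the same as a ring action `ℤ[G] →+* End X`
(`MonoidAlgebra.lift`), equivariance and stability under `G` and under `ℤ[G]` agree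
(additivity), and the `G`-equivariant Poincaré complements of
`Motives/AbelianVarietyPoincareEquivariantPerfectField` (`exists_equivariant_complement_of_fintype`,
Maschke averaging) supply the splitting hypothesis over every perfect field:

* `AbelianVariety.exists_equivariant_quasiDecomposition_of_fintype` — **over a perfect field `K`,
  every abelian variety `X` with an action `ρ : G →* End X` of a finite group `G` decomposes up to
  isogeny, `G`-EQUIVARIANTLY, into finitely many `G`-SIMPLE abelian varieties `(Sᵢ, χᵢ)`**
  (no `G`-stable abelian subvariety of dimension strictly between `0` and `dim Sᵢ`): equivariant
  `ιᵢ : Sᵢ ⟶ X`, `πᵢ : X ⟶ Sᵢ` and `N ≥ 1` with `ιᵢ ≫ πᵢ = N`, `ιᵢ ≫ πⱼ = 0` (`i ≠ j`),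
  `∑ᵢ πᵢ ≫ ιᵢ = N` — Lange–Rodríguez, *Decomposition of Jacobians by Prym Varieties*, §2.7–2.9
  (Poincaré's complete reducibility with `G`-action and the resulting decomposition into `G`-simple
  abelian subvarieties, there over `ℂ`); Mumford §19 Thm. 1 / Cor. 1 with operators.

Everything is proved; no definition, no named fact (D-0026).

## References

* H. Lange, R. E. Rodríguez, *Decomposition of Jacobians by Prym Varieties*, LNM 2310 (2022),
  §2.7 Thm. 2.7.1 and §§2.8–2.9 (isotypical and `G`-simple decompositions; held copy
  `book:lange2022-decomposition-jacobians-by-prym-varieties`, PDF pp. 38–45). [LangeRodriguez2022]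
* D. Mumford, *Abelian Varieties* (1970), §19 Thm. 1 and Cor. 1 (pp. 173–174). [MumfordAV1970]
-/

noncomputable section

universe u v

open CategoryTheory CategoryTheory.Limits AlgebraicGeometry

namespace Literature.AlgebraicGeometry.Motives

namespace AbelianVariety

variable {K : Type u} [Field K] {G : Type v} [Group G]

/-- Equivariance under `G` extends to equivariance under the group ring `ℤ[G]`: if
`f ≫ β g = α g ≫ f` on the generators `g ∈ G` of two ring actions
`α : ℤ[G] →+* End A`, `β : ℤ[G] →+* End B`, then `f ≫ β a = α a ≫ f` for all `a ∈ ℤ[G]`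
(both sides are additive in `a`). [folklore] -/
private theorem comp_eq_comp_of_forall_of {A B : AbelianVariety K}
    (α : MonoidAlgebra ℤ G →+* End A) (β : MonoidAlgebra ℤ G →+* End B) (f : A ⟶ B)
    (hf : ∀ g : G, f ≫ End.asHom (β (MonoidAlgebra.of ℤ G g)) =
      End.asHom (α (MonoidAlgebra.of ℤ G g)) ≫ f)
    (a : MonoidAlgebra ℤ G) : f ≫ End.asHom (β a) = End.asHom (α a) ≫ f := by
  induction a using MonoidAlgebra.induction_on with
  | hM g => exact hf g
  | hadd x y hx hy =>
    rw [map_add, map_add]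
    change f ≫ (End.asHom (β x) + End.asHom (β y)) = (End.asHom (α x) + End.asHom (α y)) ≫ f
    rw [Preadditive.comp_add, Preadditive.add_comp, hx, hy]
  | hsmul r x hx =>
    rw [map_zsmul, map_zsmul]
    change f ≫ (r • End.asHom (β x)) = (r • End.asHom (α x)) ≫ f
    rw [Preadditive.comp_zsmul, Preadditive.zsmul_comp, hx]

variable [Fintype G] [PerfectField K]

/-- **Decomposition up to isogeny into `G`-simple pieces, for a finite group `G`, over a perfect
field.** Every abelian variety `X` over a perfect field with an action `ρ : G →* End X` of a finite
group `G` admits finitely many abelian varieties `Sᵢ` with `G`-actions `χᵢ : G →* End Sᵢ`, each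
**`G`-simple** (no abelian variety `W` with `G`-action and equivariant closed immersion `W ↪ Sᵢ`
of dimension `0 < dim W < dim Sᵢ`), EQUIVARIANT morphisms `ιᵢ : Sᵢ ⟶ X`, `πᵢ : X ⟶ Sᵢ`
(`ιᵢ ≫ ρ g = χᵢ g ≫ ιᵢ`, `ρ g ≫ πᵢ = πᵢ ≫ χᵢ g`) and `N ≥ 1` with `ιᵢ ≫ πᵢ = N • 𝟙`,
`ιᵢ ≫ πⱼ = 0` for `i ≠ j` and `∑ᵢ πᵢ ≫ ιᵢ = N • 𝟙 X`: `X` is `G`-equivariantly isogenous to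
`⊕ᵢ Sᵢ`. [cite: LangeRodriguez2022, §2.7 Thm. 2.7.1 and §§2.8–2.9]
[cite: MumfordAV1970, §19 Thm. 1 and Cor. 1 (pp. 173–174)] -/
theorem exists_equivariant_quasiDecomposition_of_fintype (X : AbelianVariety K) (ρ : G →* End X) :
    ∃ (I : Type) (_ : Fintype I) (S : I → AbelianVariety K) (χ : ∀ i, G →* End (S i))
      (ι : ∀ i, S i ⟶ X) (π : ∀ i, X ⟶ S i) (N : ℕ),
      (∀ i, ∀ (W : AbelianVariety K) (ω : G →* End W) (w : W ⟶ S i),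
        IsClosedImmersion (Hom.toSchemeHom w) →
        (∀ g : G, w ≫ End.asHom (χ i g) = End.asHom (ω g) ≫ w) →
        0 < W.dim → W.dim < (S i).dim → False) ∧
      0 < N ∧ (∀ i, ι i ≫ π i = N • 𝟙 (S i)) ∧ (∀ i j, i ≠ j → ι i ≫ π j = 0) ∧
      ∑ i, π i ≫ ι i = N • 𝟙 X ∧
      (∀ i (g : G), ι i ≫ End.asHom (ρ g) = End.asHom (χ i g) ≫ ι i) ∧
      (∀ i (g : G), End.asHom (ρ g) ≫ π i = π i ≫ End.asHom (χ i g)) := by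
  -- abbreviations: group ring, restriction of a ring action to `G`, extension of a `G`-action
  let ZG := MonoidAlgebra ℤ G
  let res : ∀ {A : AbelianVariety K}, (ZG →+* End A) → (G →* End A) :=
    fun φ ↦ (φ : ZG →* End _).comp (MonoidAlgebra.of ℤ G)
  let ext : ∀ {A : AbelianVariety K}, (G →* End A) → (ZG →+* End A) :=
    fun ρ ↦ (MonoidAlgebra.lift ℤ (End _) G ρ).toRingHom
  have ext_of : ∀ {A : AbelianVariety K} (ρ : G →* End A) (g : G),
      ext ρ (MonoidAlgebra.of ℤ G g) = ρ g := fun ρ g ↦ by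
    change MonoidAlgebra.lift ℤ (End _) G ρ (MonoidAlgebra.of ℤ G g) = ρ g
    exact MonoidAlgebra.lift_of ρ g
  -- the splitting hypothesis for ring actions of `ℤ[G]`
  have hP : ∀ (X : AbelianVariety K) (φ : ZG →+* End X) (Y : AbelianVariety K) (ψ : ZG →+* End Y)
      (i : Y ⟶ X), IsClosedImmersion (Hom.toSchemeHom i) →
      (∀ a : ZG, i ≫ End.asHom (φ a) = End.asHom (ψ a) ≫ i) → 0 < Y.dim → Y.dim < X.dim →
      ∃ (Z : AbelianVariety K) (χ : ZG →+* End Z) (j : Z ⟶ X) (h : X ⟶ Y) (t : X ⟶ Z) (M : ℕ),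
        Z.dim < X.dim ∧ 0 < M ∧ i ≫ h = M • 𝟙 Y ∧ j ≫ t = M • 𝟙 Z ∧ i ≫ t = 0 ∧ j ≫ h = 0 ∧
        h ≫ i + t ≫ j = M • 𝟙 X ∧
        (∀ a : ZG, j ≫ End.asHom (φ a) = End.asHom (χ a) ≫ j) ∧
        (∀ a : ZG, End.asHom (φ a) ≫ h = h ≫ End.asHom (ψ a)) ∧
        (∀ a : ZG, End.asHom (φ a) ≫ t = t ≫ End.asHom (χ a)) := by
    intro X φ Y ψ i hci hi h0 _
    obtain ⟨h, M, Z, χ, j, t, hM, hih, hh, -, -, -, hdim, h1, h2, hχj, hχt⟩ :=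
      exists_equivariant_complement_of_fintype (res φ) (res ψ) i fun g ↦ hi _
    -- corners of the quasi-inverse pair `(i, j)`, `(h, t)`
    have e2 : ∀ (W W' : AbelianVariety K) (a : W ⟶ Y ⊞ Z) (b : Y ⊞ Z ⟶ W'),
        a ≫ (biprod.desc i j ≫ biprod.lift h t) ≫ b = M • (a ≫ b) := fun _ _ a b ↦ by
      rw [h2, Preadditive.nsmul_comp, Category.id_comp, Preadditive.comp_nsmul]
    have hjt : j ≫ t = M • 𝟙 Z := by
      have e := e2 _ _ biprod.inr biprod.snd
      rwa [Category.assoc, biprod.inr_desc_assoc, biprod.lift_snd, biprod.inr_snd] at e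
    have hit : i ≫ t = 0 := by
      have e := e2 _ _ biprod.inl biprod.snd
      rwa [Category.assoc, biprod.inl_desc_assoc, biprod.lift_snd, biprod.inl_snd, smul_zero] at e
    have hjh : j ≫ h = 0 := by
      have e := e2 _ _ biprod.inr biprod.fst
      rwa [Category.assoc, biprod.inr_desc_assoc, biprod.lift_fst, biprod.inr_fst, smul_zero] at e
    have htot : h ≫ i + t ≫ j = M • 𝟙 X := by rwa [biprod.lift_desc] at h1
    refine ⟨Z, ext χ, j, h, t, M, by omega, Nat.pos_of_ne_zero hM, hih, hjt, hit, hjh, htot,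
      comp_eq_comp_of_forall_of (ext χ) φ j fun g ↦ ?_,
      fun a ↦ (comp_eq_comp_of_forall_of φ ψ h (fun g ↦ (hh g).symm) a).symm,
      fun a ↦ (comp_eq_comp_of_forall_of φ (ext χ) t (fun g ↦ ?_) a).symm⟩
    · rw [ext_of]
      exact (hχj g).symm
    · rw [ext_of]
      exact hχt g
  obtain ⟨I, _, S, χ, ι, π, N, hS, hN, h1, h2, h3, he, hp⟩ :=
    exists_equivariant_quasiDecomposition_of_splitting hP X (ext ρ)
  refine ⟨I, inferInstance, S, fun i ↦ res (χ i), ι, π, N, fun i W ω w hw hwe h0 hlt ↦ ?_, hN,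
    h1, h2, h3, fun i g ↦ ?_, fun i g ↦ ?_⟩
  · exact hS i W (ext ω) w hw (comp_eq_comp_of_forall_of (ext ω) (χ i) w fun g ↦ by
      rw [ext_of]; exact hwe g) h0 hlt
  · rw [← ext_of ρ g]
    exact he i _
  · rw [← ext_of ρ g]
    exact hp i _

end AbelianVariety

end Literature.AlgebraicGeometry.Motives

end
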